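/-
Copyright (c) 2026. All rights reserved.
Released under Apache 2.0 license as described in the file LICENSE.
Authors: abc-iut cell, wave-5 discharge seat abc-iut-w5-d067.
-/
import Literature.AnabelianGeometry.AbsoluteAnabelian.MonoAnalyticLogShellsSub
import Literature.AnabelianGeometry.AbsoluteAnabelian.MonoAnalyticLogShellsSubProofs
import HarnessLib

/-!
# [AbsTopIII] Prop 5.8 (ii), sub-node P58ii/L01 — the named statement DISCHARGED

S. Mochizuki, *Topics in absolute anabelian geometry III* [MochizukiAbsTopIII2015], Prop 5.8 (ii) (manuscript
`paper:url-5493eb38cbb7` p. 139 l. 25–33). The statements-first sub-DAG statement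
`Prop58ii.OpenSubgroupIsMLFGaloisType` (`MonoAnalyticLogShellsSub.lean`: "an open subgroup of a profinite group of
MLF-Galois type is again of MLF-Galois type" — the licence for running the algorithm of Prop 5.8 (i) at every
open subgroup when the `Γ⃗×_non`-diagram of (ii) is assembled) is exactly the theorem
`Prop58ii.openSubgroup_isMLFGaloisType` of the proof-only companion `MonoAnalyticLogShellsSubProofs.lean`; this
file records the fully-qualified closing alias so that the named statement stops being an assumption
(D-0026 accounting). Proof-only; nothing here bears on [IUTchIII] Cor. 3.12.
-/

set_option autoImplicit false

universe u

namespace Literature.AnabelianGeometry.AbsoluteAnabelian.Prop58ii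

/-- **P58ii/L01 DISCHARGED**: the sub-DAG statement `OpenSubgroupIsMLFGaloisType` of [AbsTopIII] Prop 5.8 (ii)
holds (by `openSubgroup_isMLFGaloisType`). [cite: MochizukiAbsTopIII2015, Prop 5.8 (ii) p. 139] -/
theorem OpenSubgroupIsMLFGaloisType_holds :
    Literature.AnabelianGeometry.AbsoluteAnabelian.Prop58ii.OpenSubgroupIsMLFGaloisType.{u} :=
  fun G hG U => openSubgroup_isMLFGaloisType G hG U

end Literature.AnabelianGeometry.AbsoluteAnabelian.Prop58ii
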